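import Summits.AtomisticToContinuum.Crystallization.Theorems.FrustratedLawDichotomyStrainedPatchHomValueT2Kit

/-!
# (I1) part I — FOLDED COORDINATES along the segment (roadmap R2b, first half): the real folded displacement `δ` of `(ΔU, Δξ)`, the real first-order
# moments `ζ` of a label, their box bounds, and ★ the first-order identity `⟪Vq, ΔU q + V Δξ⟫ = Σ_{k<9} ζ_k δ_k` for a SYMMETRIC `ΔU`
# (27623 `(H) HomFloor`, hcp half; decomp-a2c hand-1 g41; I1-ROADMAP-g41 §4).

Conventions of `…HomValueT2Kit`: coordinates `0,1,2 = U_00,U_11,U_22`, `3 = U_01 = U_10`, `4 = U_02 = U_20`, `5 = U_12 = U_21`, `6,7,8 = ξ`; everything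
indexed by `ℕ` (junk beyond `8`), matching the `Finset.range 9` sums of `…SoundD.boxMin_le`.  Real definitions (`ent`, `dispN`, `zetaN`) + lemmas;
0 sorry; standard axioms; no instances / notation / `#eval`.  `--supports stmt-AtomisticToContinuum-27623`.
-/

noncomputable section

namespace Summit.AtomisticToContinuum.Crystallization.Theorems.FrustratedLawDichotomyStrainedPatchHomValueT2Kit

open scoped BigOperators RealInnerProductSpace
open Finset
open Literature.Analysis.ValidatedNumerics.Numerics
open Summit.AtomisticToContinuum.Crystallization.Theorems.ChargedEnergyGapNegative (E3)
open Summit.AtomisticToContinuum.Crystallization.Theorems.FrustratedLawDichotomyStrainedPatchHomCoords (apply_eq_sum_entries)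
open Summit.AtomisticToContinuum.Crystallization.Theorems.FrustratedLawDichotomyStrainedPatchHomLeafCalculus (inner_eq_sum_apply)
open Summit.AtomisticToContinuum.Crystallization.Theorems.FrustratedLawDichotomyStrainedPatchHomCurvCentreKit (cenMap cenShuf cenMap_entry cenShuf_apply)

/-! ## §1. Entries, the folded displacement, the real moments -/

/-- Entry `(a, b)` of a self-map: `(V e_b)_a`. -/
def ent (V : E3 →L[ℝ] E3) (a b : Fin 3) : ℝ := (V (EuclideanSpace.single b (1 : ℝ))) a

/-- The folded displacement of `(ΔU, Δξ)` (coordinate `k`, junk `0` beyond `8`). -/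
def dispN (ΔU : E3 →L[ℝ] E3) (Δξ : E3) (k : ℕ) : ℝ :=
  match k with
  | 0 => ent ΔU 0 0
  | 1 => ent ΔU 1 1
  | 2 => ent ΔU 2 2
  | 3 => ent ΔU 0 1
  | 4 => ent ΔU 0 2
  | 5 => ent ΔU 1 2
  | 6 => Δξ 0
  | 7 => Δξ 1
  | 8 => Δξ 2
  | _ => 0

/-- The real first-order moments `ζ_k` of a label with argument `q` at the self-map `V` (`y = Vq`): `y_a q_a`, `y_a q_b + y_b q_a`, `Σ_a V_ai y_a`. -/
def zetaN (V : E3 →L[ℝ] E3) (q : E3) (k : ℕ) : ℝ :=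
  match k with
  | 0 => (V q) 0 * q 0
  | 1 => (V q) 1 * q 1
  | 2 => (V q) 2 * q 2
  | 3 => (V q) 0 * q 1 + (V q) 1 * q 0
  | 4 => (V q) 0 * q 2 + (V q) 2 * q 0
  | 5 => (V q) 1 * q 2 + (V q) 2 * q 1
  | 6 => ∑ a : Fin 3, ent V a 0 * (V q) a
  | 7 => ∑ a : Fin 3, ent V a 1 * (V q) a
  | 8 => ∑ a : Fin 3, ent V a 2 * (V q) a
  | _ => 0

/-! ## §2. Symmetry and box bounds -/

/-- A self-adjoint self-map has symmetric entries. [folklore] -/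
theorem ent_symm_of_selfAdjoint {V : E3 →L[ℝ] E3} (hsa : ∀ v v' : E3, ⟪V v, v'⟫ = ⟪v, V v'⟫) (a b : Fin 3) : ent V a b = ent V b a := by
  have h := hsa (EuclideanSpace.single b (1 : ℝ)) (EuclideanSpace.single a (1 : ℝ))
  rw [EuclideanSpace.inner_single_right, EuclideanSpace.inner_single_left] at h
  simpa [ent] using h

/-- Entries of a difference. [formal bookkeeping] -/
theorem ent_sub (V W : E3 →L[ℝ] E3) (a b : Fin 3) : ent (V - W) a b = ent V a b - ent W a b := by
  simp [ent]

/-- Entries of the box-centre self-map. [formal bookkeeping] -/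
theorem ent_cenMap (c : (Fin 3 × Fin 3) ⊕ Fin 3 → ℤ) (a b : Fin 3) : ent (cenMap c) a b = (c (Sum.inl (a, b)) : ℝ) / SC := cenMap_entry c a b

/-- The centre self-map of a box with symmetric centre entries has symmetric entries. [formal bookkeeping] -/
theorem ent_cenMap_symm {c : (Fin 3 × Fin 3) ⊕ Fin 3 → ℤ} (hc : ∀ a b : Fin 3, c (Sum.inl (a, b)) = c (Sum.inl (b, a))) (a b : Fin 3) :
    ent (cenMap c) a b = ent (cenMap c) b a := by
  rw [ent_cenMap, ent_cenMap, hc a b]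

/-- ★ **Box bound of an entry displacement**: `|ent (U − U_c) a b| ≤ w_ab/SC`. [arithmetic] -/
theorem abs_ent_sub_cenMap_le {c w : (Fin 3 × Fin 3) ⊕ Fin 3 → ℤ} (U : E3 →L[ℝ] E3)
    (hbox : ∀ ab : Fin 3 × Fin 3, |(U (EuclideanSpace.single ab.2 (1 : ℝ))) ab.1 - (c (Sum.inl ab) : ℝ) / SC| ≤ (w (Sum.inl ab) : ℝ) / SC) (a b : Fin 3) :
    |ent (U - cenMap c) a b| ≤ (w (Sum.inl (a, b)) : ℝ) / SC := by
  rw [ent_sub, ent_cenMap]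
  exact hbox (a, b)

/-- ★ **Box bound of a shuffle displacement**: `|(ξ − ξ_c)_i| ≤ w_i/SC`. [arithmetic] -/
theorem abs_sub_cenShuf_le {c w : (Fin 3 × Fin 3) ⊕ Fin 3 → ℤ} (ξ : E3)
    (hξ : ∀ i : Fin 3, |ξ i - (c (Sum.inr i) : ℝ) / SC| ≤ (w (Sum.inr i) : ℝ) / SC) (i : Fin 3) :
    |(ξ - cenShuf c) i| ≤ (w (Sum.inr i) : ℝ) / SC := by
  rw [PiLp.sub_apply, cenShuf_apply]
  exact hξ i

/-- ★★ **FOLDED BOX BOUNDS**: for a self-adjoint `U` in the box `(c, w)` with symmetric centre entries and `ξ` in the box, every folded displacement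
coordinate of `(U − U_c, ξ − ξ_c)` is bounded by the folded half-width: `|δ_k| ≤ foldW w k / SC` (`k < 9`). [arithmetic] -/
theorem abs_dispN_le {c w : (Fin 3 × Fin 3) ⊕ Fin 3 → ℤ} (U : E3 →L[ℝ] E3) (ξ : E3) (hsa : ∀ v v' : E3, ⟪U v, v'⟫ = ⟪v, U v'⟫)
    (hc : ∀ a b : Fin 3, c (Sum.inl (a, b)) = c (Sum.inl (b, a)))
    (hbox : ∀ ab : Fin 3 × Fin 3, |(U (EuclideanSpace.single ab.2 (1 : ℝ))) ab.1 - (c (Sum.inl ab) : ℝ) / SC| ≤ (w (Sum.inl ab) : ℝ) / SC)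
    (hξ : ∀ i : Fin 3, |ξ i - (c (Sum.inr i) : ℝ) / SC| ≤ (w (Sum.inr i) : ℝ) / SC) (k : ℕ) (hk : k < 9) :
    |dispN (U - cenMap c) (ξ - cenShuf c) k| ≤ (foldW w ⟨k, hk⟩ : ℝ) / SC := by
  have hS : (0 : ℝ) < SC := SC_pos
  have hsym : ∀ a b : Fin 3, ent (U - cenMap c) a b = ent (U - cenMap c) b a := fun a b => by
    rw [ent_sub, ent_sub, ent_symm_of_selfAdjoint hsa a b, ent_cenMap_symm hc a b]
  have hE := abs_ent_sub_cenMap_le U hbox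
  have hX := abs_sub_cenShuf_le ξ hξ
  -- an off-diagonal coordinate is bounded by both member half-widths
  have hpair : ∀ a b : Fin 3, |ent (U - cenMap c) a b| ≤ ((min (w (Sum.inl (a, b))) (w (Sum.inl (b, a))) : ℤ) : ℝ) / SC := by
    intro a b
    have h1 := hE a b
    have h2 := hE b a
    rw [← hsym a b] at h2
    rw [Int.cast_min, le_div_iff₀ hS, le_min_iff]
    rw [le_div_iff₀ hS] at h1 h2
    exact ⟨h1, h2⟩
  interval_cases k <;> simp only [dispN, foldW] <;> first | exact hE _ _ | exact hpair _ _ | exact hX _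

/-! ## §3. ★ The first-order identity along the segment -/

/-- ★★ **FIRST-ORDER IDENTITY**: for a self-map `ΔU` with symmetric entries, `⟪Vq, ΔU q + V Δξ⟫ = Σ_{k<9} ζ_k(V, q)·δ_k(ΔU, Δξ)` — the derivative of
`½‖(V + sΔU)(q + sΔξ)‖²` at `s = 0` in the folded coordinates of the kit. [folklore: expansion in entries] -/
theorem inner_y_dy_eq_sum (V ΔU : E3 →L[ℝ] E3) (hsym : ∀ a b : Fin 3, ent ΔU a b = ent ΔU b a) (q Δξ : E3) :
    ⟪V q, ΔU q + V Δξ⟫ = ∑ k ∈ range 9, zetaN V q k * dispN ΔU Δξ k := by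
  have h10 := hsym 1 0
  have h20 := hsym 2 0
  have h21 := hsym 2 1
  simp only [Finset.sum_range_succ, Finset.sum_range_zero, zero_add, zetaN, dispN]
  rw [inner_eq_sum_apply]
  simp only [Fin.sum_univ_three, PiLp.add_apply, apply_eq_sum_entries ΔU q, apply_eq_sum_entries V Δξ]
  simp only [ent] at h10 h20 h21 ⊢
  rw [h10, h20, h21]
  ring

end Summit.AtomisticToContinuum.Crystallization.Theorems.FrustratedLawDichotomyStrainedPatchHomValueT2Kit
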